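import Summits.AnomalousDissipation.AnomalousDissipation.Theorems.TwoAndHalfDTwohalfdNegRegularCondensateLimitTools
import Literature.Analysis.FunctionSpaces.LpNormByDuality

/-!
# Sobolev-condensate no-go for `TwoAndHalfD.TwohalfdThesis` (stmt-AnomalousDissipation-0206), stub SC-WL2:
# weak `L²` limits on a space–time block, tested against all of `L²`

Crux `TwohalfdThesis` (= X), line `Sketch`, lead c7, section N of the skeleton (Sobolev condensates).  The
weak-limit step of the sibling regular-condensate theorem
(`Theorems/TwoAndHalfDTwohalfdNegRegularCondensateWeakLimit.lean`, `stub_rcWeakLimit`) extracts weak `L²`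
limits `Θ` of the restarted scalars `ϑ k` on the block `(0,S) × T²`, tested against BOUNDED measurable `G`
only.  With a Sobolev (unbounded) limit drift the passage to the limit in the transport term needs test
functions `G ∈ L²((0,S) × T²)`; this file is that upgrade.  Write `μ := (vol|_(0,S)) ⊗ vol` on `ℝ × T²`
(a finite measure).  If `∫∫ ϑ_k² dμ ≤ C`, `∫∫ Θ² dμ ≤ C` and `∫∫ ϑ_k G dμ → ∫∫ Θ G dμ` for every bounded
measurable `G`, then `∫∫ ϑ_k G dμ → ∫∫ Θ G dμ` for every `G ∈ L²(μ)`.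

Proof (`ε/3`; Yosida, *Functional Analysis*, Ch. V §1, Thm. 3: weak convergence of a bounded sequence need
only be tested on a strongly dense set of functionals).  Simple functions are bounded and measurable, and
dense in `L²(μ)` (`MeasureTheory.MemLp.exists_simpleFunc_eLpNorm_sub_lt`): given `G ∈ L²(μ)` and `ε > 0`
pick a simple `s` with `‖G − s‖_{L²(μ)} < δ`, where `√C · δ ≤ ε/3`; by Hölder
(`Literature.Analysis.FunctionSpaces.enorm_integral_mul_le_eLpNorm_mul_eLpNorm`)
`|∫∫ ϑ_k (G − s)| ≤ ‖ϑ_k‖_{L²} ‖G − s‖_{L²} ≤ ε/3` uniformly in `k`, the same for `Θ`, and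
`|∫∫ ϑ_k s − ∫∫ Θ s| < ε/3` eventually.

* `scWeakLimitL2_tendsto_integral_mul_of_simpleFunc` — the density upgrade on a general measure space
  (uniform `L²` bound + convergence against simple `L²` functions ⇒ convergence against all of `L²`);
* `stub_scWeakLimitL2` — the registered stub (last declaration).  Supports stmt-AnomalousDissipation-0206.

## Mathlib / Literature search

`lean search 'exists_simpleFunc_eLpNorm_sub_lt'`, `'enorm_integral_mul_le_eLpNorm_mul_eLpNorm'`,
`'tendsto_integral_mul_of'`, `'isClosed_setOf_tendsto'`: the `ε/3` step exists in the tree only inline, as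
Step 4 of `Literature.Analysis.FunctionSpaces.exists_subseq_tendsto_integral_mul_of_lintegral_rpow_le`
(`WeakCompactnessLpFinite.lean`, general `L^p`, along the Dunford–Pettis subsequence); it is adapted here
as a standalone `L²` lemma, reusing that file's Hölder pairing lemmas from `LpNormByDuality`
(`enorm_integral_mul_le_eLpNorm_mul_eLpNorm`, `integrable_mul_of_memLp`, `exists_pos_mul_ofReal_le`) and
the sibling's `rcLimit_eLpNorm_two_le_of_integral_sq_le` (`‖f‖_{L²} ≤ C^{1/2}` from `∫ f² ≤ C`).  Mathlib's
abstract route (`Equicontinuous.isClosed_setOf_tendsto` + `MeasureTheory.Lp.simpleFunc.denseRange`) would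
need the same Hölder bound plus the `Lp`-class bookkeeping, so the elementary argument is shorter.

## References

* K. Yosida, *Functional Analysis*, 6th ed., Springer 1980, Ch. V §1, Thm. 3.
* H. Brezis, *Functional Analysis, Sobolev Spaces and Partial Differential Equations*, Springer 2011,
  Prop. 3.5, Thm. 4.13 (density of simple functions). [`Brezis2011`]
-/

noncomputable section

namespace Summit.AnomalousDissipation.AnomalousDissipation.Theorems.TwohalfdThesis.SobolevCondensate

open MeasureTheory Filter Topology Set Function
open scoped ENNReal NNReal InnerProductSpace
open Literature.Analysis.FunctionSpaces Literature.Analysis.FluidPDE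
open Summit.AnomalousDissipation.AnomalousDissipation.Theorems.TwohalfdNeg.RegularCondensate

set_option linter.dupNamespace false -- the registry path `AnomalousDissipation.AnomalousDissipation`

/-! ### Weak `L²` convergence: from simple to square-integrable test functions -/

/-- **Weak convergence in `L²` need only be tested against simple functions.** On any measure space,
let `f n, g ∈ L²(μ)` be real with `‖f n‖_{L²} ≤ K`, `‖g‖_{L²} ≤ K` (`K < ∞`), and suppose
`∫ f n · s dμ → ∫ g · s dμ` for every simple `s ∈ L²(μ)`.  Then `∫ f n · ψ dμ → ∫ g · ψ dμ` for every
`ψ ∈ L²(μ)`: approximate `ψ` by a simple `s` in `L²` (`MemLp.exists_simpleFunc_eLpNorm_sub_lt`) and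
bound the two error terms by Hölder, `|∫ h (ψ - s)| ≤ ‖h‖_{L²} ‖ψ - s‖_{L²} ≤ K δ ≤ ε/3`, uniformly in
`h ∈ {f n, g}` (Yosida, *Functional Analysis*, Ch. V §1, Thm. 3). [folklore] -/
theorem scWeakLimitL2_tendsto_integral_mul_of_simpleFunc {α : Type*} [MeasurableSpace α]
    {μ : Measure α} {f : ℕ → α → ℝ} {g : α → ℝ} (hf : ∀ n, MemLp (f n) 2 μ) (hg : MemLp g 2 μ)
    {K : ℝ≥0∞} (hK : K ≠ ⊤) (hfK : ∀ n, eLpNorm (f n) 2 μ ≤ K) (hgK : eLpNorm g 2 μ ≤ K)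
    (hlim : ∀ s : SimpleFunc α ℝ, MemLp s 2 μ →
      Tendsto (fun n => ∫ x, f n x * s x ∂μ) atTop (𝓝 (∫ x, g x * s x ∂μ)))
    {ψ : α → ℝ} (hψ : MemLp ψ 2 μ) :
    Tendsto (fun n => ∫ x, f n x * ψ x ∂μ) atTop (𝓝 (∫ x, g x * ψ x ∂μ)) := by
  -- adapted from `Literature/Analysis/FunctionSpaces/WeakCompactnessLpFinite.lean`, Step 4 of
  -- `exists_subseq_tendsto_integral_mul_of_lintegral_rpow_le` (there `L^p`/`L^q`, here `p = q = 2`)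
  rw [Metric.tendsto_atTop]
  intro ε hε
  obtain ⟨δ, hδ0, hδ⟩ := exists_pos_mul_ofReal_le hK (ε := (ε / 3).toNNReal)
    (Real.toNNReal_pos.2 (by positivity))
  -- the simple approximant of `ψ` in `L²`
  obtain ⟨s, hs, hs2⟩ := hψ.exists_simpleFunc_eLpNorm_sub_lt ENNReal.ofNat_ne_top
    (ENNReal.ofReal_pos.2 hδ0).ne'
  obtain ⟨N, hN⟩ := Metric.tendsto_atTop.1 (hlim s hs2) (ε / 3) (by positivity)
  refine ⟨N, fun n hn => ?_⟩
  -- the uniform Hölder bound for the two error terms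
  have hbound : ∀ {h : α → ℝ}, MemLp h 2 μ → eLpNorm h 2 μ ≤ K →
      |∫ x, h x * (ψ x - s x) ∂μ| ≤ ε / 3 := by
    intro h hh hhK
    have e1 : ‖∫ x, h x * (ψ x - s x) ∂μ‖ₑ ≤ ENNReal.ofReal (ε / 3) :=
      calc ‖∫ x, h x * (ψ x - s x) ∂μ‖ₑ
          ≤ eLpNorm h 2 μ * eLpNorm (fun x => ψ x - s x) 2 μ :=
            enorm_integral_mul_le_eLpNorm_mul_eLpNorm hh.1 (hψ.1.sub s.aestronglyMeasurable)
        _ ≤ K * ENNReal.ofReal δ := mul_le_mul' hhK hs.le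
        _ ≤ ENNReal.ofReal (ε / 3) := hδ
    rw [← ofReal_norm, ENNReal.ofReal_le_ofReal_iff (by positivity), Real.norm_eq_abs] at e1
    exact e1
  have i1 : Integrable (fun x => f n x * ψ x) μ := integrable_mul_of_memLp (hf n) hψ
  have i2 : Integrable (fun x => f n x * s x) μ := integrable_mul_of_memLp (hf n) hs2
  have i3 : Integrable (fun x => g x * ψ x) μ := integrable_mul_of_memLp hg hψ
  have i4 : Integrable (fun x => g x * s x) μ := integrable_mul_of_memLp hg hs2
  have e1 : ∫ x, f n x * (ψ x - s x) ∂μ = (∫ x, f n x * ψ x ∂μ) - ∫ x, f n x * s x ∂μ := by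
    rw [← integral_sub i1 i2]
    exact integral_congr_ae (Eventually.of_forall fun x => by ring)
  have e2 : ∫ x, g x * (ψ x - s x) ∂μ = (∫ x, g x * ψ x ∂μ) - ∫ x, g x * s x ∂μ := by
    rw [← integral_sub i3 i4]
    exact integral_congr_ae (Eventually.of_forall fun x => by ring)
  have hA := hbound (hf n) (hfK n)
  have hB := hbound hg hgK
  have hN' := hN n hn
  rw [Real.dist_eq] at hN' ⊢
  rw [e1] at hA
  rw [e2] at hB
  have key : (∫ x, f n x * ψ x ∂μ) - ∫ x, g x * ψ x ∂μ =
      ((∫ x, f n x * ψ x ∂μ) - ∫ x, f n x * s x ∂μ) +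
        ((∫ x, f n x * s x ∂μ) - ∫ x, g x * s x ∂μ) -
        ((∫ x, g x * ψ x ∂μ) - ∫ x, g x * s x ∂μ) := by ring
  rw [key]
  calc |((∫ x, f n x * ψ x ∂μ) - ∫ x, f n x * s x ∂μ) +
        ((∫ x, f n x * s x ∂μ) - ∫ x, g x * s x ∂μ) -
        ((∫ x, g x * ψ x ∂μ) - ∫ x, g x * s x ∂μ)|
      ≤ |((∫ x, f n x * ψ x ∂μ) - ∫ x, f n x * s x ∂μ) +
          ((∫ x, f n x * s x ∂μ) - ∫ x, g x * s x ∂μ)| +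
          |(∫ x, g x * ψ x ∂μ) - ∫ x, g x * s x ∂μ| := abs_sub _ _
    _ ≤ |(∫ x, f n x * ψ x ∂μ) - ∫ x, f n x * s x ∂μ| +
          |(∫ x, f n x * s x ∂μ) - ∫ x, g x * s x ∂μ| +
          |(∫ x, g x * ψ x ∂μ) - ∫ x, g x * s x ∂μ| := by
        gcongr
        exact abs_add_le _ _
    _ < ε := by linarith

/-! ### The registered stub -/

/-- **SC-WL2 `stub_scWeakLimitL2` — weak `L²` limits on a block, tested against all of `L²`
(registered stub).** Let `μ := (vol|_(0,S)) ⊗ vol` on `ℝ × T²` with `S > 0`, and let the scalars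
`ϑ k : ℝ → T² → ℝ` and `Θ : ℝ → T² → ℝ` have `μ`-a.e. strongly measurable uncurryings and integrable
squares with `∫ ϑ_k² dμ ≤ C`, `∫ Θ² dμ ≤ C`.  If `∫ ϑ_k G dμ → ∫ Θ G dμ` for every bounded
`μ`-a.e. strongly measurable `G`, then `∫ ϑ_k G dμ → ∫ Θ G dμ` for every `G ∈ L²(μ)`: simple functions
are bounded and measurable, `‖ϑ_k‖_{L²(μ)}, ‖Θ‖_{L²(μ)} ≤ C^{1/2}`
(`rcLimit_eLpNorm_two_le_of_integral_sq_le`), and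
`scWeakLimitL2_tendsto_integral_mul_of_simpleFunc` applies (Yosida, *Functional Analysis*, Ch. V §1,
Thm. 3). [folklore] -/
theorem stub_scWeakLimitL2 :
    ∀ (S C : ℝ) (ϑ : ℕ → ℝ → UnitAddTorus (Fin 2) → ℝ) (Θ : ℝ → UnitAddTorus (Fin 2) → ℝ), 0 < S →
      (∀ k, AEStronglyMeasurable (Function.uncurry (ϑ k))
        (((volume : Measure ℝ).restrict (Set.Ioo 0 S)).prod volume)) →
      (∀ k, Integrable (fun p : ℝ × UnitAddTorus (Fin 2) => ϑ k p.1 p.2 ^ 2)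
        (((volume : Measure ℝ).restrict (Set.Ioo 0 S)).prod volume)) →
      (∀ k, ∫ p, ϑ k p.1 p.2 ^ 2 ∂(((volume : Measure ℝ).restrict (Set.Ioo 0 S)).prod volume) ≤ C) →
      AEStronglyMeasurable (Function.uncurry Θ) (((volume : Measure ℝ).restrict (Set.Ioo 0 S)).prod volume) →
      Integrable (fun p : ℝ × UnitAddTorus (Fin 2) => Θ p.1 p.2 ^ 2)
        (((volume : Measure ℝ).restrict (Set.Ioo 0 S)).prod volume) →
      ∫ p, Θ p.1 p.2 ^ 2 ∂(((volume : Measure ℝ).restrict (Set.Ioo 0 S)).prod volume) ≤ C →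
      (∀ G : ℝ × UnitAddTorus (Fin 2) → ℝ,
        AEStronglyMeasurable G (((volume : Measure ℝ).restrict (Set.Ioo 0 S)).prod volume) →
        (∃ M : ℝ, ∀ p, |G p| ≤ M) →
        Tendsto (fun k => ∫ p, ϑ k p.1 p.2 * G p ∂(((volume : Measure ℝ).restrict (Set.Ioo 0 S)).prod volume))
          atTop (𝓝 (∫ p, Θ p.1 p.2 * G p ∂(((volume : Measure ℝ).restrict (Set.Ioo 0 S)).prod volume)))) →
      ∀ G : ℝ × UnitAddTorus (Fin 2) → ℝ,
        MemLp G 2 (((volume : Measure ℝ).restrict (Set.Ioo 0 S)).prod volume) →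
        Tendsto (fun k => ∫ p, ϑ k p.1 p.2 * G p ∂(((volume : Measure ℝ).restrict (Set.Ioo 0 S)).prod volume))
          atTop (𝓝 (∫ p, Θ p.1 p.2 * G p ∂(((volume : Measure ℝ).restrict (Set.Ioo 0 S)).prod volume))) := by
  intro S C ϑ Θ _hS hm hi hC hΘm hΘi hΘC hwlim G hG
  set μ : Measure (ℝ × UnitAddTorus (Fin 2)) :=
    ((volume : Measure ℝ).restrict (Set.Ioo 0 S)).prod volume with hμ
  -- the scalars and their limit in `L²(μ)`, with norms at most `C^{1/2}`
  have hL : ∀ k, MemLp (fun p : ℝ × UnitAddTorus (Fin 2) => ϑ k p.1 p.2) 2 μ := fun k =>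
    (memLp_two_iff_integrable_sq (hm k)).2 (hi k)
  have hΘL : MemLp (fun p : ℝ × UnitAddTorus (Fin 2) => Θ p.1 p.2) 2 μ :=
    (memLp_two_iff_integrable_sq hΘm).2 hΘi
  have hKtop : ENNReal.ofReal C ^ (1 / 2 : ℝ) ≠ ⊤ :=
    ENNReal.rpow_ne_top_of_nonneg (by norm_num) ENNReal.ofReal_ne_top
  have hLK : ∀ k, eLpNorm (fun p : ℝ × UnitAddTorus (Fin 2) => ϑ k p.1 p.2) 2 μ ≤
      ENNReal.ofReal C ^ (1 / 2 : ℝ) := fun k =>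
    rcLimit_eLpNorm_two_le_of_integral_sq_le (hi k) (hC k)
  have hΘK : eLpNorm (fun p : ℝ × UnitAddTorus (Fin 2) => Θ p.1 p.2) 2 μ ≤
      ENNReal.ofReal C ^ (1 / 2 : ℝ) :=
    rcLimit_eLpNorm_two_le_of_integral_sq_le hΘi hΘC
  -- simple functions are bounded measurable test functions
  have hsimple : ∀ s : SimpleFunc (ℝ × UnitAddTorus (Fin 2)) ℝ, MemLp s 2 μ →
      Tendsto (fun k => ∫ p, ϑ k p.1 p.2 * s p ∂μ) atTop (𝓝 (∫ p, Θ p.1 p.2 * s p ∂μ)) := by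
    intro s _
    obtain ⟨M, hM⟩ := s.exists_forall_norm_le
    exact hwlim s s.aestronglyMeasurable ⟨M, fun p => by simpa [Real.norm_eq_abs] using hM p⟩
  exact scWeakLimitL2_tendsto_integral_mul_of_simpleFunc hL hΘL hKtop hLK hΘK hsimple hG

end Summit.AnomalousDissipation.AnomalousDissipation.Theorems.TwohalfdThesis.SobolevCondensate

end
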